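import Summits.HodgeConjecture.HodgeConjecture.Theses.HolomorphicityRate
import Literature.Geometry.Riemannian.RiemannianMetricExists
import Literature.AlgebraicGeometry.HodgeTheory.HodgeModelConnected
import Literature.AlgebraicGeometry.HodgeTheory.TopDegreeClasses
import Literature.AlgebraicTopology.SingularHomology.CohomologyClopenPieces
import Literature.Geometry.Kaehler.NearlyHolomorphicCycleSupport
import HarnessLib

/-!
# Route `HolomorphicityRate`, item `UniversalRateOne` (E1): the extreme codimensions `p = 0`, `p = n`

Support item `stmt-HodgeConjecture-2740` of route `route-HodgeConjecture-HolomorphicityRate` asks,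
for `X` smooth projective of dimension `n`, `p ≤ n`, a Hodge model `A` and a rational class
`c ∈ H²ᵖ(X(ℂ); ℂ)`, for a smooth metric `g`, `m ≥ 1`, a rational algebraic `hp`, `a_k ≤ C kᵖ` and
`C'` such that for all large `k` the ray class `m • c + a_k • hp` is supported on a nearly
holomorphic cycle support of codimension `p` and defect `≤ C'/k` (the predicate of
`Literature.Geometry.Kaehler.IsNearlyHolomorphicCycleSupport`, inlined in the item).

The honest range `1 ≤ p ≤ n - 1` is the Donaldson–Auroux theory of asymptotically holomorphic
sections (zero loci of uniformly transverse sections of `E ⊗ Lᵏ`), not in the tree. This file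
settles the two EXTREME codimensions, where the statement is elementary, as helpers towards the
item (same conclusion, one extra hypothesis `p = 0`, resp. `p = n`):

* `universalRateOne_of_eq_zero` (`p = 0`): take `S = X^an`, `Sg = ∅`; `X^an` is connected
  (`HodgeModel.connectedSpace_carrier`, SGA1 XII 2.4), every point is a regular point of real
  codimension `0` (no equations), and the complement `X^an ∖ S = ∅` has no cohomology
  (`isZero_singularCohomology_of_isEmpty`).
* `universalRateOne_of_eq` (`p = n`): take `S = {x₀}` a point, `Sg = ∅`; the extended chart at
  `x₀` composed with a real-linear isomorphism `A.model ≃L[ℝ] ℝ²ⁿ` is a `C¹` submersion chart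
  cutting out `{x₀}` with trivial tangent plane (defect condition vacuous), and EVERY class of
  degree `2n` dies on `X^an ∖ {x₀}`, a connected non-compact `2n`-manifold
  (`isZero_singularHomology_of_noncompactSpace_holds`, Hatcher Prop. 3.29, and universal
  coefficients over `ℂ`, `kroneckerPairing_injective_of_field`), exactly as in the tree's
  `Literature.AlgebraicGeometry.HodgeTheory.restrictCompl_pt_eq_zero` (there on `X(ℂ)`, here on
  the Hodge model).

In both cases `m = 1`, `hp = 0`, `a = 0`, `C = C' = 0`, and `g` is any smooth Riemannian metric
(`Literature.Geometry.Riemannian.nonempty_contMDiffRiemannianMetric`, Lee Prop. 13.3).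

## References

* S. K. Donaldson, *Symplectic submanifolds and almost-complex geometry*, JDG 44 (1996).
* D. Auroux, *Asymptotically holomorphic families of symplectic submanifolds*, GAFA 7 (1997).
* A. Hatcher, *Algebraic Topology* (2002), Prop. 3.29, Thm. 3.2.
-/

namespace Summit.HodgeConjecture.HodgeConjecture.Theses.HolomorphicityRate
open scoped BigOperators Topology Manifold Classical MeasureTheory ProbabilityTheory Matrix InnerProductSpace ComplexConjugate ContinuousMap in
open Filter Set Function TopologicalSpace MeasureTheory in
/-- **Record of the dropped route item `UniversalRateOne`** = stmt-HodgeConjecture-2740 (ledger signature verbatim; NOT a route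
item): route HolomorphicityRate rev 5 (2026-08-17T10:31Z) dropped the non-load-bearing item `UniversalRateOne`. The declaration `Summit.HodgeConjecture.HodgeConjecture.Theses.HolomorphicityRate.UniversalRateOne`
therefore no longer exists in the route file and this accepted module stopped elaborating (stale olean;
buildfix lane 2026-08-19). Re-created here under its original name so the result keeps building; the
statement of every previously accepted declaration in this file is unchanged. -/
def UniversalRateOne : Prop :=
  ∀ (n p : ℕ) (X : Literature.AlgebraicGeometry.Motives.SchemeOver ℂ), Literature.AlgebraicGeometry.Motives.IsSmoothProjective n X → p ≤ n → ∀ (A : Literature.AlgebraicGeometry.HodgeTheory.HodgeModel n X) (c : Literature.AlgebraicGeometry.HodgeTheory.complexBetti X (2 * p)), Literature.AlgebraicGeometry.HodgeTheory.IsRationalClass c → ∃ (g : Bundle.ContMDiffRiemannianMetric 𝓘(ℝ, A.model) ((⊤ : ℕ∞) : WithTop ℕ∞) A.model (fun x : A.carrier => TangentSpace 𝓘(ℝ, A.model) x)) (m : ℕ) (hp : Literature.AlgebraicGeometry.HodgeTheory.complexBetti X (2 * p)) (C : ℝ) (a : ℕ → ℕ) (C' : ℝ), 0 < m ∧ Literature.AlgebraicGeometry.HodgeTheory.IsRationalClass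 hp ∧ hp ∈ Literature.AlgebraicGeometry.HodgeTheory.algebraicClasses X p ∧ (∀ k, (a k : ℝ) ≤ C * (k : ℝ) ^ p) ∧ ∀ᶠ k : ℕ in Filter.atTop, ∃ S Sg : Set A.carrier, (IsClosed S ∧ IsClosed Sg ∧ Sg ⊆ S ∧ IsConnected (S \ Sg) ∧ (∀ x ∈ Sg, Literature.Geometry.Kaehler.IsAnalyticSetAt 𝓘(ℂ, A.model) S x) ∧ (∃ T : Set A.carrier, Sg ⊆ T ∧ (Literature.Geometry.Kaehler.IsAnalyticSet 𝓘(ℂ, A.model) T ∧ ∀ x ∈ Literature.Geometry.Kaehler.regularLocus 𝓘(ℂ, A.model) T, ∀ q : ℕ, Literature.Geometry.Kaehler.IsRegularPointOfCodim 𝓘(ℂ, A.model) T q x → p + 1 ≤ q)) ∧ (∀ x ∈ S \ Sg, ∃ U : Set A.carrier, IsOpen U ∧ x ∈ U ∧ ∃ f : A.carrier → (Fin (2 * p) → ℝ), ContMDiffOn 𝓘(ℝ, A.model) 𝓘(ℝ, Fin (2 * p) → ℝ) 1 f U ∧ S ∩ U = U ∩ f ⁻¹' {0} ∧ Function.Surjective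 (mfderiv 𝓘(ℝ, A.model) 𝓘(ℝ, Fin (2 * p) → ℝ) f x) ∧ ∀ v : TangentSpace 𝓘(ℝ, A.model) x, mfderiv 𝓘(ℝ, A.model) 𝓘(ℝ, Fin (2 * p) → ℝ) f x v = 0 → ∃ w : TangentSpace 𝓘(ℝ, A.model) x, mfderiv 𝓘(ℝ, A.model) 𝓘(ℝ, Fin (2 * p) → ℝ) f x w = 0 ∧ g.inner x (Literature.Geometry.Kaehler.tangentJ A.model x v - w) (Literature.Geometry.Kaehler.tangentJ A.model x v - w) ≤ (C' * (k : ℝ) ^ (-(1 : ℝ))) ^ 2 * g.inner x v v)) ∧ Literature.AlgebraicTopology.SingularHomology.singularCohomology.map ℂ ℂ (⟨Subtype.val, continuous_subtype_val⟩ : C({x : A.carrier // x ∉ S}, A.carrier)) (2 * p) (A.pullback (2 * p) (((m : ℂ) • c + ((a k : ℕ) : ℂ) • hp))) = 0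
end Summit.HodgeConjecture.HodgeConjecture.Theses.HolomorphicityRate


noncomputable section

open scoped Manifold ContDiff Topology
open Set Filter

-- `Summit.HodgeConjecture.HodgeConjecture.Theorems` is the mandated namespace (single-conjunct summit:
-- Sub = Summit), which `linter.dupNamespace` flags on every declaration; the lakefile turns the
-- linter off tree-wide (weak option), restated here so stand-alone elaboration is warning-free too.
set_option linter.dupNamespace false

namespace Summit.HodgeConjecture.HodgeConjecture.Theorems

open Literature.AlgebraicGeometry.HodgeTheory Literature.AlgebraicGeometry.Motives
  Literature.AlgebraicTopology.SingularHomology Literature.Geometry.Kaehler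

/-- **`UniversalRateOne` in codimension `p = 0`.** For `X` smooth projective, a Hodge model `A`
and any class `c ∈ H⁰(X(ℂ); ℂ)`, the conclusion of item `UniversalRateOne` holds with `S = X^an`
(connected, every point regular of real codimension `0`), `Sg = ∅`, `m = 1`, `hp = 0`, `a = 0`:
the complement of `S` is empty, so every class dies on it. [folklore] -/
theorem universalRateOne_of_eq_zero (n p : ℕ) (X : Literature.AlgebraicGeometry.Motives.SchemeOver ℂ)
    (hX : Literature.AlgebraicGeometry.Motives.IsSmoothProjective n X) (_hpn : p ≤ n) (hp0 : p = 0)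
    (A : Literature.AlgebraicGeometry.HodgeTheory.HodgeModel n X)
    (c : Literature.AlgebraicGeometry.HodgeTheory.complexBetti X (2 * p))
    (_hc : Literature.AlgebraicGeometry.HodgeTheory.IsRationalClass c) :
    ∃ (g : Bundle.ContMDiffRiemannianMetric 𝓘(ℝ, A.model) ((⊤ : ℕ∞) : WithTop ℕ∞) A.model (fun x : A.carrier => TangentSpace 𝓘(ℝ, A.model) x)) (m : ℕ) (hp : Literature.AlgebraicGeometry.HodgeTheory.complexBetti X (2 * p)) (C : ℝ) (a : ℕ → ℕ) (C' : ℝ), 0 < m ∧ Literature.AlgebraicGeometry.HodgeTheory.IsRationalClass hp ∧ hp ∈ Literature.AlgebraicGeometry.HodgeTheory.algebraicClasses X p ∧ (∀ k, (a k : ℝ) ≤ C * (k : ℝ) ^ p) ∧ ∀ᶠ k : ℕ in Filter.atTop, ∃ S Sg : Set A.carrier, (IsClosed S ∧ IsClosed Sg ∧ Sg ⊆ S ∧ IsConnected (S \ Sg) ∧ (∀ x ∈ Sg, Literature.Geometry.Kaehler.IsAnalyticSetAt 𝓘(ℂ, A.model) S x) ∧ (∃ T : Set A.carrier, Sg ⊆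 T ∧ (Literature.Geometry.Kaehler.IsAnalyticSet 𝓘(ℂ, A.model) T ∧ ∀ x ∈ Literature.Geometry.Kaehler.regularLocus 𝓘(ℂ, A.model) T, ∀ q : ℕ, Literature.Geometry.Kaehler.IsRegularPointOfCodim 𝓘(ℂ, A.model) T q x → p + 1 ≤ q)) ∧ (∀ x ∈ S \ Sg, ∃ U : Set A.carrier, IsOpen U ∧ x ∈ U ∧ ∃ f : A.carrier → (Fin (2 * p) → ℝ), ContMDiffOn 𝓘(ℝ, A.model) 𝓘(ℝ, Fin (2 * p) → ℝ) 1 f U ∧ S ∩ U = U ∩ f ⁻¹' {0} ∧ Function.Surjective (mfderiv 𝓘(ℝ, A.model) 𝓘(ℝ, Fin (2 * p) → ℝ) f x) ∧ ∀ v : TangentSpace 𝓘(ℝ, A.model) x, mfderiv 𝓘(ℝ, A.model) 𝓘(ℝ, Fin (2 * p) → ℝ) f x v = 0 → ∃ w : TangentSpace 𝓘(ℝ, A.model) x, mfderiv 𝓘(ℝ, A.model) 𝓘(ℝ, Fin (2 * p) → ℝ) f x w = 0 ∧ g.inner x (Literature.Geometry.Kaehler.tangentJ A.model x v - w) (Literature.Geometry.Kaehler.tangentJ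 A.model x v - w) ≤ (C' * (k : ℝ) ^ (-(1 : ℝ))) ^ 2 * g.inner x v v)) ∧ Literature.AlgebraicTopology.SingularHomology.singularCohomology.map ℂ ℂ (⟨Subtype.val, continuous_subtype_val⟩ : C({x : A.carrier // x ∉ S}, A.carrier)) (2 * p) (A.pullback (2 * p) (((m : ℂ) • c + ((a k : ℕ) : ℂ) • hp))) = 0 := by
  subst hp0
  haveI : ConnectedSpace A.carrier := A.connectedSpace_carrier hX
  obtain ⟨g⟩ := Literature.Geometry.Riemannian.nonempty_contMDiffRiemannianMetric
    (I := 𝓘(ℝ, A.model)) (M := A.carrier)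
  refine ⟨g, 1, 0, 0, fun _ => 0, 0, one_pos, IsRationalClass.zero, Submodule.zero_mem _,
    fun k => by simp, Filter.Eventually.of_forall fun k => ⟨Set.univ, ∅, ?_, ?_⟩⟩
  · refine ⟨isClosed_univ, isClosed_empty, Set.empty_subset _, ?_, fun x hx => hx.elim,
      ⟨∅, Set.empty_subset _, isAnalyticSet_empty, fun x hx =>
        ((regularLocus_subset (I := 𝓘(ℂ, A.model)) (∅ : Set A.carrier)) hx).elim⟩, ?_⟩
    · rw [Set.sdiff_empty]
      exact isConnected_univ
    · intro x _
      refine ⟨Set.univ, isOpen_univ, Set.mem_univ x, fun _ => 0, contMDiffOn_const, ?_, ?_, ?_⟩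
      · ext y
        simp
      · intro y
        refine ⟨0, ?_⟩
        rw [map_zero]
        exact funext fun i => absurd i.2 (by omega)
      · intro v _
        refine ⟨Literature.Geometry.Kaehler.tangentJ A.model x v, ?_, ?_⟩
        · exact funext fun i => absurd i.2 (by omega)
        · rw [sub_self, map_zero]
          exact mul_nonneg (sq_nonneg _) (riemannianMetric_inner_self_nonneg g.toRiemannianMetric x v)
  · -- the complement of `S = univ` is empty: no cohomology
    haveI : IsEmpty {x : A.carrier // x ∉ (Set.univ : Set A.carrier)} :=
      ⟨fun x => x.2 (Set.mem_univ _)⟩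
    haveI := ModuleCat.subsingleton_of_isZero
      (isZero_singularCohomology_of_isEmpty (R := ℂ)
        (Y := {x : A.carrier // x ∉ (Set.univ : Set A.carrier)}) (2 * 0))
    exact Subsingleton.elim _ _

/-- **`UniversalRateOne` in codimension `p = n`.** For `X` smooth projective of dimension `n`, a
Hodge model `A` and any class `c ∈ H²ⁿ(X(ℂ); ℂ)`, the conclusion of item `UniversalRateOne` holds
with `S = {x₀}` a point of `X^an` (a connected real `C¹` submanifold of codimension `2n`, cut out by
the extended chart at `x₀` followed by a real-linear isomorphism `A.model ≃L[ℝ] ℝ²ⁿ`, whose tangent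
plane `0` has every defect), `Sg = ∅`, `m = 1`, `hp = 0`, `a = 0`: every class of degree `2n` dies
on `X^an ∖ {x₀}`, a connected non-compact `2n`-manifold (`H₂ₙ = 0`, Hatcher Prop. 3.29, and
universal coefficients over `ℂ`). For `n = 0` this is the case `p = 0`.
[cite: HatcherAT2002, §3.3 Prop. 3.29 and §3.1 Thm. 3.2] -/
theorem universalRateOne_of_eq (n p : ℕ) (X : Literature.AlgebraicGeometry.Motives.SchemeOver ℂ)
    (hX : Literature.AlgebraicGeometry.Motives.IsSmoothProjective n X) (hpn : p ≤ n) (hpe : p = n)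
    (A : Literature.AlgebraicGeometry.HodgeTheory.HodgeModel n X)
    (c : Literature.AlgebraicGeometry.HodgeTheory.complexBetti X (2 * p))
    (hc : Literature.AlgebraicGeometry.HodgeTheory.IsRationalClass c) :
    ∃ (g : Bundle.ContMDiffRiemannianMetric 𝓘(ℝ, A.model) ((⊤ : ℕ∞) : WithTop ℕ∞) A.model (fun x : A.carrier => TangentSpace 𝓘(ℝ, A.model) x)) (m : ℕ) (hp : Literature.AlgebraicGeometry.HodgeTheory.complexBetti X (2 * p)) (C : ℝ) (a : ℕ → ℕ) (C' : ℝ), 0 < m ∧ Literature.AlgebraicGeometry.HodgeTheory.IsRationalClass hp ∧ hp ∈ Literature.AlgebraicGeometry.HodgeTheory.algebraicClasses X p ∧ (∀ k, (a k : ℝ) ≤ C * (k : ℝ) ^ p) ∧ ∀ᶠ k : ℕ in Filter.atTop, ∃ S Sg : Set A.carrier, (IsClosed S ∧ IsClosed Sg ∧ Sg ⊆ S ∧ IsConnected (S \ Sg) ∧ (∀ x ∈ Sg, Literature.Geometry.Kaehler.IsAnalyticSetAt 𝓘(ℂ, A.model) S x) ∧ (∃ T : Set A.carrier, Sg ⊆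 T ∧ (Literature.Geometry.Kaehler.IsAnalyticSet 𝓘(ℂ, A.model) T ∧ ∀ x ∈ Literature.Geometry.Kaehler.regularLocus 𝓘(ℂ, A.model) T, ∀ q : ℕ, Literature.Geometry.Kaehler.IsRegularPointOfCodim 𝓘(ℂ, A.model) T q x → p + 1 ≤ q)) ∧ (∀ x ∈ S \ Sg, ∃ U : Set A.carrier, IsOpen U ∧ x ∈ U ∧ ∃ f : A.carrier → (Fin (2 * p) → ℝ), ContMDiffOn 𝓘(ℝ, A.model) 𝓘(ℝ, Fin (2 * p) → ℝ) 1 f U ∧ S ∩ U = U ∩ f ⁻¹' {0} ∧ Function.Surjective (mfderiv 𝓘(ℝ, A.model) 𝓘(ℝ, Fin (2 * p) → ℝ) f x) ∧ ∀ v : TangentSpace 𝓘(ℝ, A.model) x, mfderiv 𝓘(ℝ, A.model) 𝓘(ℝ, Fin (2 * p) → ℝ) f x v = 0 → ∃ w : TangentSpace 𝓘(ℝ, A.model) x, mfderiv 𝓘(ℝ, A.model) 𝓘(ℝ, Fin (2 * p) → ℝ) f x w = 0 ∧ g.inner x (Literature.Geometry.Kaehler.tangentJ A.model x v - w) (Literature.Geometry.Kaehler.tangentJ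 A.model x v - w) ≤ (C' * (k : ℝ) ^ (-(1 : ℝ))) ^ 2 * g.inner x v v)) ∧ Literature.AlgebraicTopology.SingularHomology.singularCohomology.map ℂ ℂ (⟨Subtype.val, continuous_subtype_val⟩ : C({x : A.carrier // x ∉ S}, A.carrier)) (2 * p) (A.pullback (2 * p) (((m : ℂ) • c + ((a k : ℕ) : ℂ) • hp))) = 0 := by
  subst hpe
  rcases Nat.eq_zero_or_pos p with hp0 | hp
  · exact universalRateOne_of_eq_zero p p X hX hpn hp0 A c hc
  haveI : ConnectedSpace A.carrier := A.connectedSpace_carrier hX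
  obtain ⟨x₀⟩ := A.nonempty_carrier hX
  obtain ⟨g⟩ := Literature.Geometry.Riemannian.nonempty_contMDiffRiemannianMetric
    (I := 𝓘(ℝ, A.model)) (M := A.carrier)
  -- real dimension of the model space
  have hrk : Module.finrank ℝ A.model = 2 * p := by
    rw [finrank_real_of_complex, A.isAnalytification.finrank_eq]
  refine ⟨g, 1, 0, 0, fun _ => 0, 0, one_pos, IsRationalClass.zero, Submodule.zero_mem _,
    fun k => by simp, Filter.Eventually.of_forall fun k => ⟨{x₀}, ∅, ?_, ?_⟩⟩
  · refine ⟨isClosed_singleton, isClosed_empty, Set.empty_subset _, ?_, fun x hx => hx.elim,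
      ⟨∅, Set.empty_subset _, isAnalyticSet_empty, fun x hx =>
        ((regularLocus_subset (I := 𝓘(ℂ, A.model)) (∅ : Set A.carrier)) hx).elim⟩, ?_⟩
    · rw [Set.sdiff_empty]
      exact isConnected_singleton
    · intro x hx
      rw [Set.sdiff_empty, Set.mem_singleton_iff] at hx
      subst hx
      -- the submersion chart: extended chart at `x` followed by `A.model ≃L[ℝ] ℝ^{2p}`
      have hfin : Module.finrank ℝ A.model = Module.finrank ℝ (Fin (2 * p) → ℝ) := by
        rw [hrk, Module.finrank_fin_fun]
      let L : A.model ≃L[ℝ] (Fin (2 * p) → ℝ) := ContinuousLinearEquiv.ofFinrankEq hfin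
      set φ := extChartAt 𝓘(ℝ, A.model) x with hφ
      -- the differential of the chart at `x` is invertible
      obtain ⟨e, he⟩ :=
        isInvertible_mfderiv_extChartAt (I := 𝓘(ℝ, A.model)) (mem_extChartAt_source x)
      have hφ' : HasMFDerivAt 𝓘(ℝ, A.model) 𝓘(ℝ, A.model) φ x
          (e : TangentSpace 𝓘(ℝ, A.model) x →L[ℝ] TangentSpace 𝓘(ℝ, A.model) (φ x)) := by
        rw [he]
        exact (mdifferentiableAt_extChartAt (mem_chart_source A.model x)).hasMFDerivAt
      have hg : HasMFDerivAt 𝓘(ℝ, A.model) 𝓘(ℝ, Fin (2 * p) → ℝ)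
          (fun z : A.model => L z - L (φ x)) (φ x) (L : A.model →L[ℝ] (Fin (2 * p) → ℝ)) :=
        hasMFDerivAt_iff_hasFDerivAt.2
          ((L : A.model →L[ℝ] (Fin (2 * p) → ℝ)).hasFDerivAt.sub_const _)
      have hf : HasMFDerivAt 𝓘(ℝ, A.model) 𝓘(ℝ, Fin (2 * p) → ℝ)
          (fun y => L (φ y) - L (φ x)) x
          ((L : A.model →L[ℝ] (Fin (2 * p) → ℝ)).comp
            (e : TangentSpace 𝓘(ℝ, A.model) x →L[ℝ] TangentSpace 𝓘(ℝ, A.model) (φ x))) :=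
        hg.comp x hφ'
      refine ⟨φ.source, isOpen_extChartAt_source x, mem_extChartAt_source x,
        fun y => L (φ y) - L (φ x), ?_, ?_, ?_, ?_⟩
      · -- real `C¹` on the chart domain
        have hφs : ContMDiffOn 𝓘(ℝ, A.model) 𝓘(ℝ, A.model) 1 φ φ.source := by
          rw [hφ, extChartAt_source]
          exact contMDiffOn_extChartAt
        exact ((L : A.model →L[ℝ] (Fin (2 * p) → ℝ)).contMDiff.comp_contMDiffOn hφs).sub
          contMDiffOn_const
      · -- `{x} ∩ U = U ∩ f⁻¹(0)`
        ext y
        simp only [Set.mem_inter_iff, Set.mem_singleton_iff, Set.mem_preimage, sub_eq_zero,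
          EmbeddingLike.apply_eq_iff_eq]
        constructor
        · rintro ⟨rfl, hy⟩
          exact ⟨hy, rfl⟩
        · rintro ⟨hy, hyx⟩
          exact ⟨φ.injOn hy (mem_extChartAt_source x) hyx, hy⟩
      · -- surjective differential
        rw [hf.mfderiv]
        exact L.surjective.comp e.surjective
      · -- the tangent plane is `0`: every defect
        intro v hv
        rw [hf.mfderiv] at hv
        have hv0 : v = 0 := e.map_eq_zero_iff.1 (L.map_eq_zero_iff.1 hv)
        subst hv0
        refine ⟨0, map_zero _, ?_⟩
        simp
  · -- every class of degree `2p = 2 dim` dies on the punctured model `X^an ∖ {x₀}`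
    -- `A.carrier` as a topological `2p`-manifold charted on `ℝ^{2p}`
    have hfinE : Module.finrank ℝ A.model = Module.finrank ℝ (EuclideanSpace ℝ (Fin (2 * p))) := by
      rw [hrk, finrank_euclideanSpace_fin]
    let eC : A.model ≃ₜ EuclideanSpace ℝ (Fin (2 * p)) :=
      (ContinuousLinearEquiv.ofFinrankEq hfinE).toHomeomorph
    letI csE : ChartedSpace (EuclideanSpace ℝ (Fin (2 * p))) A.carrier :=
      { atlas := Set.range fun q : A.carrier => (chartAt A.model q).transHomeomorph eC
        chartAt := fun q => (chartAt A.model q).transHomeomorph eC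
        mem_chart_source := fun q => by
          rw [OpenPartialHomeomorph.transHomeomorph_source]
          exact mem_chart_source A.model q
        chart_mem_atlas := fun q => ⟨q, rfl⟩ }
    haveI : LocallyPathConnectedSpace A.carrier :=
      ChartedSpace.locallyPathConnectedSpace (H := A.model) (M := A.carrier)
    haveI : PathConnectedSpace A.carrier := pathConnectedSpace_iff_connectedSpace.2 inferInstance
    -- the open subset `U = X^an ∖ {x₀}`
    let U : TopologicalSpace.Opens A.carrier :=
      ⟨{x : A.carrier | x ∉ ({x₀} : Set A.carrier)}, isOpen_compl_singleton⟩
    have hU : (U : Set A.carrier) = {x₀}ᶜ := rfl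
    -- `U` is a connected `2p`-manifold (`2p ≥ 2`)
    haveI : ConnectedSpace U := by
      have hpc : IsPathConnected ({x₀}ᶜ : Set A.carrier) :=
        Literature.AlgebraicTopology.Homotopy.isPathConnected_compl_singleton_of_chartedSpace
          (E := A.model) (by rw [hrk]; omega) x₀
      rw [← hU] at hpc
      exact isConnected_iff_connectedSpace.1 hpc.isConnected
    -- `U` is not compact: otherwise it would be closed and `x₀` isolated
    haveI : NoncompactSpace U := by
      rw [← not_compactSpace_iff]
      intro hcU
      have hcpt : IsCompact (U : Set A.carrier) := isCompact_iff_compactSpace.2 hcU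
      have hclosed : IsClosed ({x₀}ᶜ : Set A.carrier) := hU ▸ hcpt.isClosed
      have hopen : IsOpen ({x₀} : Set A.carrier) := isClosed_compl_iff.1 hclosed
      exact not_isOpen_singleton_of_chartedSpace (d := 2 * p) (by omega) x₀ hopen
    -- Hatcher Prop. 3.29 and universal coefficients over `ℂ`
    have h0 : CategoryTheory.Limits.IsZero (singularHomology ℂ ℂ U (2 * p)) :=
      isZero_singularHomology_of_noncompactSpace_holds ℂ U (2 * p) le_rfl
    haveI := ModuleCat.subsingleton_of_isZero h0
    haveI : Subsingleton (singularCohomology ℂ ℂ U (2 * p)) :=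
      (kroneckerPairing_injective_of_field ℂ U (2 * p)).subsingleton
    have hsub : Subsingleton
        (singularCohomology ℂ ℂ {x : A.carrier // x ∉ ({x₀} : Set A.carrier)} (2 * p)) := ‹_›
    exact Subsingleton.elim _ _


/-- **Reduction of `UniversalRateOne` to the middle codimensions `1 ≤ p ≤ n - 1`.** The route decl
`UniversalRateOne` follows from its restriction to `0 < p < n` (hence `n ≥ 2`): the cases `p = 0`
and `p = n` are `universalRateOne_of_eq_zero` and `universalRateOne_of_eq`. The remaining range is
exactly where the Donaldson–Auroux construction is needed (zero loci of asymptotically holomorphic,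
uniformly transverse sections of `E ⊗ Lᵏ`, connected by the Lefschetz hyperplane property for
`p ≤ n - 1`, Auroux 1997 Prop. 1, Cor. 1, Prop. 2); it is taken here as the hypothesis `H`.
[cite: Auroux1997, Prop. 1, Cor. 1 and Prop. 2] -/
theorem universalRateOne_of_forall_pos_of_lt
    (H : ∀ (n p : ℕ) (X : Literature.AlgebraicGeometry.Motives.SchemeOver ℂ),
      Literature.AlgebraicGeometry.Motives.IsSmoothProjective n X → 0 < p → p < n →
      ∀ (A : Literature.AlgebraicGeometry.HodgeTheory.HodgeModel n X)
        (c : Literature.AlgebraicGeometry.HodgeTheory.complexBetti X (2 * p)),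
        Literature.AlgebraicGeometry.HodgeTheory.IsRationalClass c → ∃ (g : Bundle.ContMDiffRiemannianMetric 𝓘(ℝ, A.model) ((⊤ : ℕ∞) : WithTop ℕ∞) A.model (fun x : A.carrier => TangentSpace 𝓘(ℝ, A.model) x)) (m : ℕ) (hp : Literature.AlgebraicGeometry.HodgeTheory.complexBetti X (2 * p)) (C : ℝ) (a : ℕ → ℕ) (C' : ℝ), 0 < m ∧ Literature.AlgebraicGeometry.HodgeTheory.IsRationalClass hp ∧ hp ∈ Literature.AlgebraicGeometry.HodgeTheory.algebraicClasses X p ∧ (∀ k, (a k : ℝ) ≤ C * (k : ℝ) ^ p) ∧ ∀ᶠ k : ℕ in Filter.atTop, ∃ S Sg : Set A.carrier, (IsClosed S ∧ IsClosed Sg ∧ Sg ⊆ S ∧ IsConnected (S \ Sg) ∧ (∀ x ∈ Sg, Literature.Geometry.Kaehler.IsAnalyticSetAt 𝓘(ℂ, A.model) S x) ∧ (∃ T : Set A.carrier, Sg ⊆ T ∧ (Literature.Geometry.Kaehler.IsAnalyticSet 𝓘(ℂ, A.model) T ∧ ∀ x ∈ Literature.Geometry.Kaehler.regularLocus 𝓘(ℂ,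 A.model) T, ∀ q : ℕ, Literature.Geometry.Kaehler.IsRegularPointOfCodim 𝓘(ℂ, A.model) T q x → p + 1 ≤ q)) ∧ (∀ x ∈ S \ Sg, ∃ U : Set A.carrier, IsOpen U ∧ x ∈ U ∧ ∃ f : A.carrier → (Fin (2 * p) → ℝ), ContMDiffOn 𝓘(ℝ, A.model) 𝓘(ℝ, Fin (2 * p) → ℝ) 1 f U ∧ S ∩ U = U ∩ f ⁻¹' {0} ∧ Function.Surjective (mfderiv 𝓘(ℝ, A.model) 𝓘(ℝ, Fin (2 * p) → ℝ) f x) ∧ ∀ v : TangentSpace 𝓘(ℝ, A.model) x, mfderiv 𝓘(ℝ, A.model) 𝓘(ℝ, Fin (2 * p) → ℝ) f x v = 0 → ∃ w : TangentSpace 𝓘(ℝ, A.model) x, mfderiv 𝓘(ℝ, A.model) 𝓘(ℝ, Fin (2 * p) → ℝ) f x w = 0 ∧ g.inner x (Literature.Geometry.Kaehler.tangentJ A.model x v - w) (Literature.Geometry.Kaehler.tangentJ A.model x v - w) ≤ (C' * (k : ℝ) ^ (-(1 : ℝ))) ^ 2 * g.inner x v v)) ∧ Literature.AlgebraicTopology.SingularHomology.singularCohomology.map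 ℂ ℂ (⟨Subtype.val, continuous_subtype_val⟩ : C({x : A.carrier // x ∉ S}, A.carrier)) (2 * p) (A.pullback (2 * p) (((m : ℂ) • c + ((a k : ℕ) : ℂ) • hp))) = 0) :
    Summit.HodgeConjecture.HodgeConjecture.Theses.HolomorphicityRate.UniversalRateOne := by
  intro n p X hX hpn A c hc
  rcases Nat.eq_zero_or_pos p with hp0 | hp
  · exact universalRateOne_of_eq_zero n p X hX hpn hp0 A c hc
  rcases hpn.lt_or_eq with hlt | heq
  · exact H n p X hX hp hlt A c hc
  · exact universalRateOne_of_eq n p X hX hpn heq A c hc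

end Summit.HodgeConjecture.HodgeConjecture.Theorems

end
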